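import Mathlib.RepresentationTheory.Character
import Mathlib.RepresentationTheory.Irreducible
import Mathlib.RingTheory.SimpleModule.Rank
import Mathlib.Analysis.SpecialFunctions.Pow.Real
import Mathlib.Algebra.BigOperators.Finprod
import HarnessLib

/-!
# Character degrees of a finite group

Topic `Literature/RepresentationTheory`; definition request `defn-maxCharDegree` (for
`stmt-MatrixMultiplication-0597`, group-theoretic matrix multiplication with non-abelian groups:
Cohn–Umans 2003, Thm. 1.8 / 4.1; Cohn–Kleinberg–Szegedy–Umans 2005, Thm. 5.5).

## Content

For a finite group `G`, `ℂ[G] ≅ ℂ^{d₁×d₁} × ⋯ × ℂ^{d_k×d_k}`; "these numbers are called the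
*character degrees* of `G`, or the dimensions of the irreducible representations. It follows from
computing the dimensions of both sides that `|G| = ∑ᵢ dᵢ²`" (Cohn–Umans 2003, §1.3). We index the
irreducible representations canonically by their **characters** (pairwise distinct by
orthonormality, Mathlib `Representation.char_orthonormal`), using Mathlib's unbundled
`Representation ℂ G V`, `Representation.IsIrreducible`, `Representation.character`:

* `IsIrrChar G χ`, `irrChars G : Set (G → ℂ)` — irreducible complex characters;
* `charDegrees G : Set ℕ` — the set of degrees `dim V` of irreducible representations
  (`= χ(1)`, `IsIrrChar.exists_apply_one`);
* `maxCharDegree G = d_max(G) := sSup (charDegrees G)` (a conditionally complete supremum in `ℕ`);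
* `charDegreePowSum G s := ∑ᶠ_{χ irreducible} χ(1)^s ∈ ℝ` (the quantity `∑ᵢ dᵢ^ω` of
  Cohn–Umans 2003, Thm. 1.8 / 4.1; a `finsum`, junk `0` were the family infinite).

Named facts (statements only): `irrChars_finite` (finitely many irreducible characters) and
`sum_sq_charDegrees` (`∑ χ(1)² = |G|`) [Cohn–Umans 2003, §1.3]; `sq_charDegree_le`
(`d² ≤ |G| - 1` for every character degree of a non-trivial group) [Cohn–Umans 2003, §4:
"the maximum possible character degree for any non-trivial group is `(|G| - 1)^{1/2}`"].

Proved API: characters of irreducibles take the value `dim` at `1`; one-dimensional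
representations are irreducible (`isIrreducible_of_finrank_eq_one`), so `1 ∈ charDegrees G`
(the trivial character) and `charDegrees G` is non-empty; `le_maxCharDegree`;
`bddAbove_charDegrees` from the fact `sq_charDegree_le`.

## Design choices

* Characters rather than isomorphism classes of `FDRep ℂ G` index the irreducibles: this is
  canonical, universe-free, and makes `∑ᵢ f(dᵢ)` a `finsum` over a `Set (G → ℂ)`.
* `G : Type` (universe `0`) since the coefficient field is `ℂ : Type` and Mathlib's character
  theory (`FDRep`) wants group and field in one universe; ample for finite groups.
* Mathlib has: Maschke, characters, orthonormality, Schur, `finrank_eq_one_of_isMulCommutative`;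
  it does not (at the pin) enumerate the irreducible representations of a finite group or prove
  `∑ dᵢ² = |G|`, hence the two named facts.
-/

noncomputable section

open scoped BigOperators
open Module

namespace Literature.RepresentationTheory.FiniteGroups

variable (G : Type) [Group G]

/-- `χ` is an **irreducible complex character** of `G`: the character of some irreducible
finite-dimensional complex representation (Cohn–Umans 2003, §1.3: "the dimensions of the
irreducible representations"; Serre, *Linear Representations*, §2.1). [cite: CohnUmans2003, §1.3] -/
def IsIrrChar (χ : G → ℂ) : Prop :=
  ∃ (V : Type) (_ : AddCommGroup V) (_ : Module ℂ V) (_ : FiniteDimensional ℂ V)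
    (ρ : Representation ℂ G V), ρ.IsIrreducible ∧ ρ.character = χ

/-- The set of irreducible complex characters of `G`. [cite: CohnUmans2003, §1.3] -/
def irrChars : Set (G → ℂ) :=
  {χ | IsIrrChar G χ}

/-- The **character degrees** of `G`: the set of dimensions `dᵢ` of the irreducible complex
representations (Cohn–Umans 2003, §1.3). As a *set* (multiplicities are recovered by summing
over `irrChars`, see `charDegreePowSum`). [cite: CohnUmans2003, §1.3] -/
def charDegrees : Set ℕ :=
  {d | ∃ (V : Type) (_ : AddCommGroup V) (_ : Module ℂ V) (_ : FiniteDimensional ℂ V)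
    (ρ : Representation ℂ G V), ρ.IsIrreducible ∧ finrank ℂ V = d}

/-- The **largest character degree** `d_max(G)`: the supremum (in `ℕ`, conditionally complete;
a maximum once `charDegrees G` is known finite/bounded, junk otherwise) of the character
degrees (Cohn–Umans 2003, §4: `|G|^{1/γ}` "is the maximum character degree of `G`"). [cite: CohnUmans2003, §4] -/
def maxCharDegree : ℕ :=
  sSup (charDegrees G)

/-- The **power sum of the character degrees** `∑ᵢ dᵢ^s = ∑_{χ irreducible} χ(1)^s` (real
exponent `s`, e.g. `s = ω` in Cohn–Umans 2003, Thm. 1.8 / Thm. 4.1: `(nmp)^{ω/3} ≤ ∑ᵢ dᵢ^ω`);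
a `finsum` over the irreducible characters (junk `0` were there infinitely many). [cite: CohnUmans2003, Thm. 4.1] -/
def charDegreePowSum (s : ℝ) : ℝ :=
  ∑ᶠ χ ∈ irrChars G, (χ 1).re ^ s

/-! ### Named facts -/

/-- A finite group has **finitely many** irreducible complex characters (as many as Wedderburn
blocks `ℂ^{dᵢ×dᵢ}` of `ℂ[G]`, Cohn–Umans 2003, §1.3; equivalently as many as conjugacy
classes, Serre §2.5 Thm. 7 — the count is not asserted here). Statement only. [cite: CohnUmans2003, §1.3] -/
def irrChars_finite : Prop :=
  ∀ (G : Type) [Group G] [Finite G], (irrChars G).Finite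

/-- **`|G| = ∑ᵢ dᵢ²`**: the squares of the character degrees, summed over the irreducible
characters, add up to the order of the group (Cohn–Umans 2003, §1.3, from
`ℂ[G] ≅ ∏ ℂ^{dᵢ×dᵢ}`). Statement only. [cite: CohnUmans2003, §1.3] -/
def sum_sq_charDegrees : Prop :=
  ∀ (G : Type) [Group G] [Finite G], ∑ᶠ χ ∈ irrChars G, χ 1 ^ 2 = (Nat.card G : ℂ)

/-- **`d_max ≤ (|G| - 1)^{1/2}`**: "the maximum possible character degree for any non-trivial group
is `(|G| - 1)^{1/2}`" (Cohn–Umans 2003, §4), i.e. `d² ≤ |G| - 1` for every character degree `d`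
of a non-trivial finite group (from `∑ dᵢ² = |G|` and the trivial character). Statement only. [cite: CohnUmans2003, §4] -/
def sq_charDegree_le : Prop :=
  ∀ (G : Type) [Group G] [Finite G] [Nontrivial G], ∀ d ∈ charDegrees G, d ^ 2 ≤ Nat.card G - 1

/-! ### API -/

variable {G}

/-- An irreducible character takes the value `dim V` at `1`. [folklore] -/
theorem IsIrrChar.exists_apply_one {χ : G → ℂ} (h : IsIrrChar G χ) :
    ∃ d ∈ charDegrees G, χ 1 = d := by
  obtain ⟨V, _, _, hV, ρ, hρ, rfl⟩ := h
  exact ⟨finrank ℂ V, ⟨V, _, _, hV, ρ, hρ, rfl⟩, ρ.char_one⟩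

/-- Every character degree is the value at `1` of an irreducible character. [folklore] -/
theorem exists_isIrrChar_of_mem_charDegrees {d : ℕ} (h : d ∈ charDegrees G) :
    ∃ χ ∈ irrChars G, χ 1 = d := by
  obtain ⟨V, _, _, hV, ρ, hρ, rfl⟩ := h
  exact ⟨ρ.character, ⟨V, _, _, hV, ρ, hρ, rfl⟩, ρ.char_one⟩

/-- **One-dimensional representations are irreducible.** [folklore] -/
theorem isIrreducible_of_finrank_eq_one {V : Type*} [AddCommGroup V] [Module ℂ V]
    (ρ : Representation ℂ G V) (h : finrank ℂ V = 1) : ρ.IsIrreducible := by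
  have hs : IsSimpleModule ℂ V := isSimpleModule_iff_finrank_eq_one.2 h
  have hinj := Subrepresentation.toSubmodule_injective (ρ := ρ)
  have hbot : (⊥ : Subrepresentation ρ).toSubmodule = ⊥ := rfl
  have htop : (⊤ : Subrepresentation ρ).toSubmodule = ⊤ := rfl
  haveI : Nontrivial (Subrepresentation ρ) := ⟨⟨⊥, ⊤, fun e => by
    have := congrArg Subrepresentation.toSubmodule e
    rw [hbot, htop] at this
    exact bot_ne_top this⟩⟩
  refine ⟨fun W => ?_⟩
  rcases eq_bot_or_eq_top W.toSubmodule with hW | hW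
  · exact Or.inl (hinj (hW.trans hbot.symm))
  · exact Or.inr (hinj (hW.trans htop.symm))

/-- The trivial representation on `ℂ` is irreducible. [folklore] -/
theorem isIrreducible_trivial : (Representation.trivial ℂ G ℂ).IsIrreducible :=
  isIrreducible_of_finrank_eq_one _ (finrank_self ℂ)

/-- `1` is a character degree (the trivial representation). [folklore] -/
theorem one_mem_charDegrees : 1 ∈ charDegrees G :=
  ⟨ℂ, _, _, inferInstance, Representation.trivial ℂ G ℂ, isIrreducible_trivial, finrank_self ℂ⟩

/-- The trivial character is an irreducible character. [folklore] -/
theorem character_trivial_mem_irrChars :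
    (Representation.trivial ℂ G ℂ).character ∈ irrChars G :=
  ⟨ℂ, _, _, inferInstance, _, isIrreducible_trivial, rfl⟩

/-- The set of character degrees is non-empty. [folklore] -/
theorem charDegrees_nonempty : (charDegrees G).Nonempty :=
  ⟨1, one_mem_charDegrees⟩

/-- Every character degree is at most `d_max`, provided the degrees are bounded (always true for
finite `G`, cf. `bddAbove_charDegrees`). [folklore] -/
theorem le_maxCharDegree (hb : BddAbove (charDegrees G)) {d : ℕ} (hd : d ∈ charDegrees G) :
    d ≤ maxCharDegree G :=
  le_csSup hb hd

/-- `1 ≤ d_max` (bounded case). [folklore] -/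
theorem one_le_maxCharDegree (hb : BddAbove (charDegrees G)) : 1 ≤ maxCharDegree G :=
  le_maxCharDegree hb one_mem_charDegrees

/-- From the fact `sq_charDegree_le`: the character degrees of a non-trivial finite group are
bounded (by `|G|`), so `maxCharDegree` is a genuine maximum. [cite: CohnUmans2003, §4] -/
theorem bddAbove_charDegrees (h : sq_charDegree_le) [Finite G] [Nontrivial G] :
    BddAbove (charDegrees G) := by
  refine ⟨Nat.card G, fun d hd => ?_⟩
  have h2 := h G d hd
  nlinarith [Nat.sub_le (Nat.card G) 1]

/-- From the fact `sq_charDegree_le`: `d_max(G)² ≤ |G| - 1` for non-trivial finite `G`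
(Cohn–Umans 2003, §4). [cite: CohnUmans2003, §4] -/
theorem sq_maxCharDegree_le (h : sq_charDegree_le) [Finite G] [Nontrivial G] :
    maxCharDegree G ^ 2 ≤ Nat.card G - 1 :=
  h G _ (Nat.sSup_mem charDegrees_nonempty (bddAbove_charDegrees h))

end Literature.RepresentationTheory.FiniteGroups

end
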